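import Literature.Analysis.FluidPDE.Seregin2023.TypeIIScenarioExcluded
import Literature.Analysis.FluidPDE.Seregin2023.PolynomialScenarioExcluded
import HarnessLib

/-!
# The consequences of Seregin 2026, Thm 2.1, now UNCONDITIONAL (polynomial weights are continuous)

Proof-only companion (no definition, no named fact) of `TypeIIScenarioExcluded.lean` (same
directory), which PROVES G. Seregin, arXiv:2606.29468 (2026) [`Seregin2026`], Theorem 2.1, for
continuous scenario weights (`seregin2026_typeII_scenario_excluded_continuousWeight_holds`). The
sibling `PolynomialScenarioExcluded.lean` derives six consequences of Theorem 2.1 CONDITIONALLY on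
the named fact `seregin2026_typeII_scenario_excluded` (`(h : …)`), each instantiating the theorem at
a power weight `f(r) = r^θ`, `θ > 0` — which is continuous on `]0,1]`. This file re-derives the six
with the hypothesis `h` DISCHARGED (same statements minus the binder `h`, same proofs with the
proved theorem in place of `h`), in the namespace
`seregin2026_typeII_scenario_excluded_continuousWeight`:

* `.polynomial`, `.not_polynomialGrowth` — the polynomial scenario (1.8)–(1.9) of G. Seregin,
  arXiv:2304.04045 = Commun. Pure Appl. Anal. 23 (2024) [`Seregin2023`] is excluded
  ([Seregin2026] Thm 2.1 with pp. 3–4);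
* `.not_seregin2024AxisymScenario`, `.not_seregin2024AxisymScenario_cknC` — the scenario (1.2)–(1.3)
  of G. Seregin, arXiv:2402.13229 (2024) [`Seregin2024AxisymTypeII`] is empty;
* `.tendsto_cubic_seregin2025`, `.tendsto_cknC_seregin2025` — the conclusion (1.6) of G. Seregin,
  arXiv:2507.08733 (2025) [`Seregin2025TypeIIScenario`] Thm 1.1 from its hypothesis (1.1) alone.

## References

* G. Seregin, arXiv:2606.29468 (2026), Thm 2.1 (p. 5), proof pp. 6–7. [`Seregin2026`]
* G. Seregin, arXiv:2304.04045 = Commun. Pure Appl. Anal. 23 (2024), (1.8)–(1.12), Prop. 1.2. [`Seregin2023`]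
* G. Seregin, arXiv:2402.13229 (2024), (1.2)–(1.3), Prop. 2.3, Cor. 2.4. [`Seregin2024AxisymTypeII`]
* G. Seregin, arXiv:2507.08733 (2025), Thm 1.1. [`Seregin2025TypeIIScenario`]
-/

noncomputable section

open _root_.MeasureTheory _root_.Set _root_.Filter _root_.Metric _root_.Function
  _root_.TopologicalSpace
open scoped _root_.ENNReal _root_.NNReal _root_.Topology

namespace Literature.Analysis.FluidPDE.Seregin2023

namespace seregin2026_typeII_scenario_excluded_continuousWeight

variable {v : ℝ → EuclideanSpace ℝ (Fin 3) → EuclideanSpace ℝ (Fin 3)}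
  {q : ℝ → EuclideanSpace ℝ (Fin 3) → ℝ}
  {G : ℝ → EuclideanSpace ℝ (Fin 3) → EuclideanSpace ℝ (Fin 3) →L[ℝ] EuclideanSpace ℝ (Fin 3)}
  {s l η m₀ m : ℝ}

/-- **The polynomial scenario of [Seregin2023] is excluded** (unconditional form of
`seregin2026_typeII_scenario_excluded.polynomial`): for a suitable weak solution `(v,q)` in `Q`
with weak gradient `G`, `1 < s < p(η)`, `1 < l < q(η)`, `0 < κ(s,l) < l`, `0 ≤ η ≤ 1`,
`0 < m₀ < 1`, `α = alpha2023 s l m₀` and the weighted bound (1.9) with `f(r) = r^{α-1}`,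
`r^{(1-m₀)κ} M^{s,l}_κ(v, r) → 0` as `r → 0⁺`. Proof: the PROVED Theorem 2.1
(`seregin2026_typeII_scenario_excluded_continuousWeight_holds`) at `f = r^{α-1}` — continuous on
`]0,1]` — and `g = r^{(1-m₀)κ}`; (2.4) by `alpha2023_exponent_identity`.
[cite: Seregin2026, Thm 2.1 (p. 5) with p. 3–4 (polynomial `f`, `g`); Seregin2023, (1.8)–(1.10)] -/
theorem polynomial
    (hv : IsSuitableWeakSolutionInBall 1 0 v q)
    (hG : HasWeakSpatialGradientOn
      (parabolicCylinderOpens 1 (0 : ℝ × EuclideanSpace ℝ (Fin 3))) v G)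
    (hs : 1 < s) (hl : 1 < l) (hκ : 0 < kappa s l) (hκl : kappa s l < l)
    (hη : η ∈ Icc (0 : ℝ) 1) (hsp : s < pEta η) (hlq : l < qEta η) (hm₀ : m₀ ∈ Ioo (0 : ℝ) 1)
    (hbound : ∃ M₁ : ℝ≥0,
      HasWeightedEnergyBound (fun r => r ^ (alpha2023 s l m₀ - 1)) M₁ v q G) :
    Tendsto
      (fun r : ℝ => ENNReal.ofReal (r ^ ((1 - m₀) * kappa s l)) *
        morreyM (kappa s l) s l (0 : ℝ × EuclideanSpace ℝ (Fin 3)) v r)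
      (𝓝[>] 0) (𝓝 0) := by
  set θ : ℝ := alpha2023 s l m₀ - 1 with hθdef
  set K : ℝ := (1 - m₀) * kappa s l with hKdef
  have hθ : 0 < θ := by
    have := one_lt_alpha2023 hs hl hκ hm₀
    simp only [hθdef]
    linarith
  have hK : 0 < K := mul_pos (by linarith [hm₀.2]) hκ
  have hs0 : 0 < s := by linarith
  have hl0 : 0 < l := by linarith
  have hp0 : 0 < pEta η := lt_trans hs0 hsp
  have hsp' : 0 < 1 - s / pEta η := by
    rw [sub_pos, div_lt_one hp0]
    exact hsp
  -- the exponent of `λ` in (2.4) and its sign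
  set e₁ : ℝ := l / 2 * (1 + 3 / s) - 3 / 2 * (1 - s / pEta η) * (l / s) with he₁
  have hid : θ * (l / 2 * (1 + 3 / s)) = (1 + θ / 2) * K :=
    alpha2023_exponent_identity hs hl hκ hm₀
  have hE : θ * e₁ - (1 + θ / 2) * K = -(θ * (3 / 2 * (1 - s / pEta η) * (l / s))) := by
    rw [he₁, mul_sub, hid]
    ring
  have hEneg : θ * e₁ - (1 + θ / 2) * K < 0 := by
    rw [hE, neg_lt_zero]
    have : 0 < l / s := div_pos hl0 hs0
    positivity
  -- (2.4) for `f = λ^θ`, `g = r^K`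
  have h24 : Tendsto
      (fun lam : ℝ => (lam ^ θ) ^ e₁ * ((lam * Real.sqrt (lam ^ θ)) ^ K)⁻¹) (𝓝[>] 0) atTop := by
    have hlim := tendsto_rpow_neg_nhdsGT_zero hEneg
    refine hlim.congr' ?_
    filter_upwards [self_mem_nhdsWithin] with lam hlam
    have hl' : 0 < lam := hlam
    have hsq : Real.sqrt (lam ^ θ) = lam ^ (θ / 2) := by
      rw [Real.sqrt_eq_rpow, ← Real.rpow_mul hl'.le]
      congr 1
      ring
    have h1 : (lam ^ θ) ^ e₁ = lam ^ (θ * e₁) := (Real.rpow_mul hl'.le θ e₁).symm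
    have h2 : lam * Real.sqrt (lam ^ θ) = lam ^ (1 + θ / 2) := by
      rw [hsq, Real.rpow_add hl', Real.rpow_one]
    have h3 : ((lam * Real.sqrt (lam ^ θ)) ^ K)⁻¹ = lam ^ (-((1 + θ / 2) * K)) := by
      rw [h2, ← Real.rpow_mul hl'.le, Real.rpow_neg hl'.le]
    rw [h1, h3, ← Real.rpow_add hl', sub_eq_add_neg]
  -- the power weight is continuous on `]0,1]`
  have hcont : ContinuousOn (fun r : ℝ => r ^ θ) (Ioc (0 : ℝ) 1) :=
    (Real.continuous_rpow_const hθ.le).continuousOn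
  -- apply the PROVED Theorem 2.1
  have hmain := seregin2026_typeII_scenario_excluded_continuousWeight_holds v q G (fun r => r ^ θ)
    (fun a => a ^ θ) (fun r => r ^ K) s l η hv hG (isScenarioWeight_rpow hθ) hcont hbound
    (fun r hr => Real.rpow_pos_of_pos hr.1 K) hs hl hκ hκl hη hsp hlq h24
  simpa only [hKdef] using hmain

/-- The growth condition (1.8) of [Seregin2023] is incompatible with (1.9) and (1.12) (`s, l > 1`)
(unconditional form of `seregin2026_typeII_scenario_excluded.not_polynomialGrowth`).
[cite: Seregin2026, Thm 2.1 (p. 5) and p. 3–4; Seregin2023, Prop. 1.2 with (1.8)–(1.12)] -/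
theorem not_polynomialGrowth
    (hv : IsSuitableWeakSolutionInBall 1 0 v q)
    (hG : HasWeakSpatialGradientOn
      (parabolicCylinderOpens 1 (0 : ℝ × EuclideanSpace ℝ (Fin 3))) v G)
    (hs : 1 < s) (hl : 1 < l) (hκ : 0 < kappa s l) (hκl : kappa s l < l)
    (hη : η ∈ Icc (0 : ℝ) 1) (hsp : s < pEta η) (hlq : l < qEta η) (hm₀ : m₀ ∈ Ioo (0 : ℝ) 1)
    (hbound : ∃ M₁ : ℝ≥0,
      HasWeightedEnergyBound (fun r => r ^ (alpha2023 s l m₀ - 1)) M₁ v q G) :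
    ¬ ∃ (ε₀ : ℝ) (r : ℕ → ℝ), 0 < ε₀ ∧ (∀ k, r k ∈ Ioo (0 : ℝ) 1) ∧ Tendsto r atTop (𝓝 0) ∧
        ∀ k, ENNReal.ofReal ε₀ ≤
          ENNReal.ofReal (r k ^ ((1 - m₀) * kappa s l)) *
            morreyM (kappa s l) s l (0 : ℝ × EuclideanSpace ℝ (Fin 3)) v (r k) := by
  rintro ⟨ε₀, r, hε₀, hr, hr0, hge⟩
  have hlim := polynomial hv hG hs hl hκ hκl hη hsp hlq hm₀ hbound
  have hrw : Tendsto r atTop (𝓝[>] 0) :=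
    tendsto_nhdsWithin_iff.2 ⟨hr0, Eventually.of_forall fun k => (hr k).1⟩
  have hseq := hlim.comp hrw
  have hle : ENNReal.ofReal ε₀ ≤ 0 :=
    ge_of_tendsto' hseq fun k => hge k
  have : ENNReal.ofReal ε₀ = 0 := le_antisymm hle bot_le
  exact absurd (ENNReal.ofReal_eq_zero.1 this) (not_le.2 hε₀)

/-- **The scenario (1.2)–(1.3) of [Seregin2024AxisymTypeII] is EMPTY** (unconditional form of
`seregin2026_typeII_scenario_excluded.not_seregin2024AxisymScenario`): for a suitable weak solution
in `Q` with weak gradient `G` (no symmetry assumed), `0 < m₀ < 1`, and (1.3) in the form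
`HasWeightedEnergyBound (r ↦ r^{1-3m₀/(2+m₀)}) c v q G`, the growth condition (1.2)
`r_k^{-2m₀} ∫_{Q(r_k)} |v|³ ≥ c₁ > 0` fails along every `r_k → 0` in `]0,1[`.
[cite: Seregin2024AxisymTypeII, (1.2)–(1.3) (p. 2), Prop. 2.3 (p. 7); Seregin2026, Thm 2.1 (p. 5)] -/
theorem not_seregin2024AxisymScenario
    (hv : IsSuitableWeakSolutionInBall 1 0 v q)
    (hG : HasWeakSpatialGradientOn
      (parabolicCylinderOpens 1 (0 : ℝ × EuclideanSpace ℝ (Fin 3))) v G)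
    (hm₀ : m₀ ∈ Ioo (0 : ℝ) 1)
    (hbound : ∃ M₁ : ℝ≥0,
      HasWeightedEnergyBound (fun r => r ^ (1 - 3 * m₀ / (2 + m₀))) M₁ v q G) :
    ¬ ∃ (c₁ : ℝ) (r : ℕ → ℝ), 0 < c₁ ∧ (∀ k, r k ∈ Ioo (0 : ℝ) 1) ∧ Tendsto r atTop (𝓝 0) ∧
        ∀ k, ENNReal.ofReal c₁ ≤
          ENNReal.ofReal (r k ^ (-(2 * m₀))) *
            ∫⁻ w in parabolicCylinder (r k) (0 : ℝ × EuclideanSpace ℝ (Fin 3)),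
              ‖v w.1 w.2‖ₑ ^ (3 : ℕ) := by
  rintro ⟨c₁, r, hc₁, hr, hr0, hge⟩
  have h3p : (3 : ℝ) < pEta 0 := by
    rw [pEta_zero]
    norm_num
  have h3q : (3 : ℝ) < qEta 0 := by
    rw [qEta_zero]
    norm_num
  have hκ : 0 < kappa 3 3 := by
    rw [kappa_three_three]
    norm_num
  have hκl : kappa 3 3 < 3 := by
    rw [kappa_three_three]
    norm_num
  have hη : (0 : ℝ) ∈ Icc (0 : ℝ) 1 := ⟨le_rfl, zero_le_one⟩
  have hbound' : ∃ M₁ : ℝ≥0,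
      HasWeightedEnergyBound (fun r => r ^ (alpha2023 3 3 m₀ - 1)) M₁ v q G := by
    rw [alpha2023_three_three_sub_one hm₀.1.le]
    exact hbound
  refine not_polynomialGrowth hv hG (by norm_num : (1 : ℝ) < 3) (by norm_num : (1 : ℝ) < 3)
    hκ hκl hη h3p h3q hm₀ hbound' ⟨c₁, r, hc₁, hr, hr0, fun k => ?_⟩
  have hsub : parabolicCylinder (r k) (0 : ℝ × EuclideanSpace ℝ (Fin 3)) ⊆
      (parabolicCylinderOpens 1 (0 : ℝ × EuclideanSpace ℝ (Fin 3)) :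
        Set (ℝ × EuclideanSpace ℝ (Fin 3))) := by
    rw [coe_parabolicCylinderOpens]
    have h2 : (r k) ^ 2 ≤ 1 ^ 2 := pow_le_pow_left₀ (hr k).1.le (hr k).2.le 2
    exact prod_mono (Ioo_subset_Ioo (by linarith) le_rfl) (ball_subset_ball (hr k).2.le)
  have hmeas : AEStronglyMeasurable (uncurry v)
      (volume.restrict (parabolicCylinder (r k) (0 : ℝ × EuclideanSpace ℝ (Fin 3)))) :=
    hG.locallyIntegrableOn.aestronglyMeasurable.mono_set hsub
  rw [weightedMorreyM_three_three_eq (hr k).1 hmeas m₀]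
  exact hge k

/-- The same exclusion with (1.2) written through the tree's `C(v,r) = r^{-2} ∫_{Q(r)} |v|³`
(`cknC`) (unconditional form of `seregin2026_typeII_scenario_excluded.not_seregin2024AxisymScenario_cknC`).
[cite: Seregin2024AxisymTypeII, (1.2)–(1.3) (p. 2); Seregin2026, Thm 2.1 (p. 5)] -/
theorem not_seregin2024AxisymScenario_cknC
    (hv : IsSuitableWeakSolutionInBall 1 0 v q)
    (hG : HasWeakSpatialGradientOn
      (parabolicCylinderOpens 1 (0 : ℝ × EuclideanSpace ℝ (Fin 3))) v G)
    (hm₀ : m₀ ∈ Ioo (0 : ℝ) 1)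
    (hbound : ∃ M₁ : ℝ≥0,
      HasWeightedEnergyBound (fun r => r ^ (1 - 3 * m₀ / (2 + m₀))) M₁ v q G) :
    ¬ ∃ (c₁ : ℝ) (r : ℕ → ℝ), 0 < c₁ ∧ (∀ k, r k ∈ Ioo (0 : ℝ) 1) ∧ Tendsto r atTop (𝓝 0) ∧
        ∀ k, ENNReal.ofReal c₁ ≤
          ENNReal.ofReal (r k ^ (2 - 2 * m₀)) *
            cknC (r k) (0 : ℝ × EuclideanSpace ℝ (Fin 3)) v := by
  rintro ⟨c₁, r, hc₁, hr, hr0, hge⟩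
  refine not_seregin2024AxisymScenario hv hG hm₀ hbound ⟨c₁, r, hc₁, hr, hr0, fun k => ?_⟩
  rw [rpow_mul_lintegral_eq_rpow_mul_cknC (hr k).1 m₀]
  exact hge k

/-- **(1.6) of [Seregin2025TypeIIScenario] Thm 1.1 from (1.1) alone** (unconditional form of
`seregin2026_typeII_scenario_excluded.tendsto_cubic_seregin2025`): for a suitable weak solution in
`Q` with weak gradient `G`, `0 < m < 1` and `HasWeightedEnergyBound (r ↦ r^{1-m}) M₁ v q G`,
`r^{-2m₀} ∫_{Q(r)} |v|³ → 0` as `r → 0⁺`, `m₀ = 2m/(3-m)`.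
[cite: Seregin2025TypeIIScenario, Thm 1.1 with (1.1), (1.6) and Rem. 1.2 (i) (pp. 2–3); Seregin2026, Thm 2.1 (p. 5)] -/
theorem tendsto_cubic_seregin2025
    (hv : IsSuitableWeakSolutionInBall 1 0 v q)
    (hG : HasWeakSpatialGradientOn
      (parabolicCylinderOpens 1 (0 : ℝ × EuclideanSpace ℝ (Fin 3))) v G)
    (hm : m ∈ Ioo (0 : ℝ) 1)
    (hbound : ∃ M₁ : ℝ≥0, HasWeightedEnergyBound (fun r => r ^ (1 - m)) M₁ v q G) :
    Tendsto
      (fun r : ℝ => ENNReal.ofReal (r ^ (-(2 * (2 * m / (3 - m))))) *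
        ∫⁻ w in parabolicCylinder r (0 : ℝ × EuclideanSpace ℝ (Fin 3)), ‖v w.1 w.2‖ₑ ^ (3 : ℕ))
      (𝓝[>] 0) (𝓝 0) := by
  set m₀ : ℝ := 2 * m / (3 - m) with hm₀def
  have hm₀ : m₀ ∈ Ioo (0 : ℝ) 1 := m0_mem_Ioo hm
  have h3p : (3 : ℝ) < pEta 0 := by
    rw [pEta_zero]
    norm_num
  have h3q : (3 : ℝ) < qEta 0 := by
    rw [qEta_zero]
    norm_num
  have hκ : 0 < kappa 3 3 := by
    rw [kappa_three_three]
    norm_num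
  have hκl : kappa 3 3 < 3 := by
    rw [kappa_three_three]
    norm_num
  have hη : (0 : ℝ) ∈ Icc (0 : ℝ) 1 := ⟨le_rfl, zero_le_one⟩
  have hexp : alpha2023 3 3 m₀ - 1 = 1 - m := by
    rw [alpha2023_three_three_sub_one hm₀.1.le, hm₀def, m_eq_of_m0 (by linarith [hm.2])]
  have hbound' : ∃ M₁ : ℝ≥0,
      HasWeightedEnergyBound (fun r => r ^ (alpha2023 3 3 m₀ - 1)) M₁ v q G := by
    rw [hexp]
    exact hbound
  have hlim := polynomial hv hG (by norm_num : (1 : ℝ) < 3) (by norm_num : (1 : ℝ) < 3)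
    hκ hκl hη h3p h3q hm₀ hbound'
  refine hlim.congr' ?_
  filter_upwards [Ioo_mem_nhdsGT (zero_lt_one' ℝ)] with r hr
  have hsub : parabolicCylinder r (0 : ℝ × EuclideanSpace ℝ (Fin 3)) ⊆
      (parabolicCylinderOpens 1 (0 : ℝ × EuclideanSpace ℝ (Fin 3)) :
        Set (ℝ × EuclideanSpace ℝ (Fin 3))) := by
    rw [coe_parabolicCylinderOpens]
    have h2 : r ^ 2 ≤ 1 ^ 2 := pow_le_pow_left₀ hr.1.le hr.2.le 2
    exact prod_mono (Ioo_subset_Ioo (by linarith) le_rfl) (ball_subset_ball hr.2.le)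
  have hmeas : AEStronglyMeasurable (uncurry v)
      (volume.restrict (parabolicCylinder r (0 : ℝ × EuclideanSpace ℝ (Fin 3)))) :=
    hG.locallyIntegrableOn.aestronglyMeasurable.mono_set hsub
  exact weightedMorreyM_three_three_eq hr.1 hmeas m₀

/-- The same limit through `C(v,r) = r^{-2} ∫_{Q(r)} |v|³` (`cknC`): `r^{2-2m₀} C(v; Q(r)) → 0`,
`m₀ = 2m/(3-m)` (unconditional form of `seregin2026_typeII_scenario_excluded.tendsto_cknC_seregin2025`).
[cite: Seregin2025TypeIIScenario, Thm 1.1 (1.6) (p. 2); Seregin2026, Thm 2.1 (p. 5)] -/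
theorem tendsto_cknC_seregin2025
    (hv : IsSuitableWeakSolutionInBall 1 0 v q)
    (hG : HasWeakSpatialGradientOn
      (parabolicCylinderOpens 1 (0 : ℝ × EuclideanSpace ℝ (Fin 3))) v G)
    (hm : m ∈ Ioo (0 : ℝ) 1)
    (hbound : ∃ M₁ : ℝ≥0, HasWeightedEnergyBound (fun r => r ^ (1 - m)) M₁ v q G) :
    Tendsto
      (fun r : ℝ => ENNReal.ofReal (r ^ (2 - 2 * (2 * m / (3 - m)))) *
        cknC r (0 : ℝ × EuclideanSpace ℝ (Fin 3)) v)
      (𝓝[>] 0) (𝓝 0) := by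
  refine (tendsto_cubic_seregin2025 hv hG hm hbound).congr' ?_
  filter_upwards [self_mem_nhdsWithin] with r hr
  exact rpow_mul_lintegral_eq_rpow_mul_cknC hr _

end seregin2026_typeII_scenario_excluded_continuousWeight

end Literature.Analysis.FluidPDE.Seregin2023

end
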